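import Mathlib.LinearAlgebra.Matrix.NonsingularInverse
import Mathlib.LinearAlgebra.Matrix.SchurComplement
import HarnessLib

/-!
# Exact renormalisation of a quadratic regulator under Gaussian convolution: the matrix algebra

Integrating a centred Gaussian field `ζ` of covariance `C` against the exponential of a quadratic form,
`E_C e^{½(ζ+φ)ᵀM(ζ+φ)} = det(1 − CM)^{−1/2} · e^{½ φᵀ M′ φ}` with `M′ := M(1 − CM)⁻¹`
(see `Literature/Probability/Distributions/GaussianQuadraticTilt.lean`), replaces the "regulator" `M` by
the **renormalised regulator** `M′ = M(1 − CM)⁻¹` and produces the determinant `det(1 − CM)`. This file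
collects the purely algebraic identities behind the bookkeeping of such regulators along a (finite-range,
multiscale) decomposition `C = Σⱼ Cⱼ` of the covariance — valid over any commutative ring, no positivity:

* `mul_one_sub_mul_comm`, `mul_inv_one_sub_mul` — push-through: `M(1 − CM) = (1 − MC)M`,
  `M(1 − CM)⁻¹ = (1 − MC)⁻¹M`;
* **tower / semigroup** (`one_sub_mul_renorm_mul_one_sub_mul`, `det_one_sub_add_mul`,
  `renorm_renorm`): `(1 − C₂M′)(1 − C₁M) = 1 − (C₁ + C₂)M`, hence
  `det(1 − (C₁+C₂)M) = det(1 − C₁M)·det(1 − C₂M′)` and `M′(1 − C₂M′)⁻¹ = M(1 − (C₁+C₂)M)⁻¹` —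
  integrating `C₁` then `C₂` costs the same determinant and ends with the same regulator as integrating
  `C₁ + C₂` at once; iterated along a sequence (`regFlow`, `regFlow_eq`, `prod_det_regFlow`):
  `Mⱼ₊₁ = Mⱼ(1 − CⱼMⱼ)⁻¹`, `Π_{j<n} det(1 − CⱼMⱼ) = det(1 − (Σ_{j<n}Cⱼ)M)`, `Mₙ = M(1 − (Σ_{j<n}Cⱼ)M)⁻¹`;
* **finite-range additivity** (`one_sub_mul_mul_one_sub_mul_of_mul_mul_eq_zero`,
  `det_one_sub_mul_add_of_mul_mul_eq_zero`, `renorm_add_of_mul_mul_eq_zero`, Finset versions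
  `det_one_sub_mul_sum_of_pairwise`, `renorm_sum_of_pairwise`): if two regulators do not interact through
  `C` (`M_X C M_Y = 0 = M_Y C M_X`, e.g. supports farther apart than the range of `C`) then
  `(1 − CM_X)(1 − CM_Y) = 1 − C(M_X + M_Y)`, the determinant is multiplicative and the renormalised
  regulator is additive over the components;
* **support** (`renorm_eq_sandwich`, `regFlow_eq_sandwich`): if `M = PMP` for an idempotent `P` then
  `M′ = PM′P` (and `Mⱼ = PMⱼP` along the flow) — the renormalised regulator never leaves the support of
  `M`; `mul_mul_eq_zero_of_sandwich` + `diagonal_mul_mul_diagonal_eq_zero` supply the non-interaction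
  hypothesis `M_X C M_Y = 0` from a vanishing block of `C` between the two supports (finite range).

Context: these are the identities (α)–(γ) invoked for the `(1−ε₀)`-critical large-field regulator of the
line `fat-gaussian-defect-calculus` of crux `BalabanIR.BirComplexStableXYR` (Hubbard summit); the
analytic half (the Gaussian integral itself) is in `GaussianQuadraticTilt.lean`. All [folklore]
(Gaussian integration of exponentials of quadratic forms; for the renormalisation-group context see
[cite: BauerschmidtBrydgesSlade2019Gaussian, Ch. 2 (Gaussian integrals in finite dimensions; progressive
integration over a covariance decomposition)] and [cite: BauerschmidtBrydgesSlade2019, Ch. 3 (finite-range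
decomposition)]).
-/

open Matrix
open scoped BigOperators

namespace Literature.Analysis.Matrix

variable {ι : Type*} [Fintype ι] [DecidableEq ι] {R : Type*} [CommRing R]

/-! ### Push-through -/

/-- `M(1 − CM) = (1 − MC)M`. [folklore] -/
theorem mul_one_sub_mul_comm (C M : Matrix ι ι R) : M * (1 - C * M) = (1 - M * C) * M := by
  rw [Matrix.mul_sub, Matrix.sub_mul, Matrix.mul_one, Matrix.one_mul, Matrix.mul_assoc]

/-- `det(1 − CM)` is a unit iff `det(1 − MC)` is. [folklore] -/
theorem isUnit_det_one_sub_mul_comm {C M : Matrix ι ι R} (h : IsUnit (1 - C * M).det) :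
    IsUnit (1 - M * C).det := by
  rwa [Matrix.det_one_sub_mul_comm]

/-- **Push-through identity** `M(1 − CM)⁻¹ = (1 − MC)⁻¹M` (when `1 − CM` is invertible). [folklore] -/
theorem mul_inv_one_sub_mul {C M : Matrix ι ι R} (h : IsUnit (1 - C * M).det) :
    M * (1 - C * M)⁻¹ = (1 - M * C)⁻¹ * M := by
  have h' : IsUnit (1 - M * C).det := isUnit_det_one_sub_mul_comm h
  calc M * (1 - C * M)⁻¹
      = (1 - M * C)⁻¹ * ((1 - M * C) * M) * (1 - C * M)⁻¹ := by
        rw [Matrix.nonsing_inv_mul_cancel_left _ _ h']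
    _ = (1 - M * C)⁻¹ * (M * (1 - C * M)) * (1 - C * M)⁻¹ := by rw [mul_one_sub_mul_comm]
    _ = (1 - M * C)⁻¹ * M := by
        rw [Matrix.mul_assoc, Matrix.mul_nonsing_inv_cancel_right _ _ h]

/-- The renormalised regulator annihilates every vector the regulator annihilates. [folklore] -/
theorem renorm_mulVec_eq_zero {C M : Matrix ι ι R} (h : IsUnit (1 - C * M).det) {v : ι → R}
    (hv : M *ᵥ v = 0) : (M * (1 - C * M)⁻¹) *ᵥ v = 0 := by
  rw [mul_inv_one_sub_mul h, ← Matrix.mulVec_mulVec, hv, Matrix.mulVec_zero]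

/-- **Support of the renormalised regulator**: if `M = PMP` for an idempotent `P` (e.g. the coordinate
projection onto a set of sites) then also `M(1 − CM)⁻¹ = P·M(1 − CM)⁻¹·P`. [folklore] -/
theorem renorm_eq_sandwich {C M P : Matrix ι ι R} (h : IsUnit (1 - C * M).det) (hP : P * P = P)
    (hM : M = P * M * P) : M * (1 - C * M)⁻¹ = P * (M * (1 - C * M)⁻¹) * P := by
  have hPM : P * M = M := by
    rw [hM, ← Matrix.mul_assoc, ← Matrix.mul_assoc, hP]
  have hMP : M * P = M := by
    rw [hM, Matrix.mul_assoc, hP]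
  conv_rhs => rw [mul_inv_one_sub_mul h, Matrix.mul_assoc, Matrix.mul_assoc, hMP,
    ← mul_inv_one_sub_mul h, ← Matrix.mul_assoc, hPM]

/-! ### Tower (semigroup) identities -/

/-- **Tower identity**: with `M′ = M(1 − C₁M)⁻¹`, `(1 − C₂M′)(1 − C₁M) = 1 − (C₁ + C₂)M`. [folklore] -/
theorem one_sub_mul_renorm_mul_one_sub_mul {C₁ M : Matrix ι ι R} (C₂ : Matrix ι ι R)
    (h₁ : IsUnit (1 - C₁ * M).det) :
    (1 - C₂ * (M * (1 - C₁ * M)⁻¹)) * (1 - C₁ * M) = 1 - (C₁ + C₂) * M := by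
  rw [Matrix.sub_mul, Matrix.one_mul, Matrix.mul_assoc, Matrix.mul_assoc,
    Matrix.nonsing_inv_mul _ h₁, Matrix.mul_one, Matrix.add_mul]
  abel

/-- **Determinant factorisation along the tower**:
`det(1 − (C₁+C₂)M) = det(1 − C₁M) · det(1 − C₂M′)`, `M′ = M(1 − C₁M)⁻¹`. [folklore] -/
theorem det_one_sub_add_mul {C₁ M : Matrix ι ι R} (C₂ : Matrix ι ι R) (h₁ : IsUnit (1 - C₁ * M).det) :
    (1 - (C₁ + C₂) * M).det = (1 - C₁ * M).det * (1 - C₂ * (M * (1 - C₁ * M)⁻¹)).det := by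
  rw [← one_sub_mul_renorm_mul_one_sub_mul C₂ h₁, Matrix.det_mul, mul_comm]

/-- `1 − (C₁+C₂)M` is invertible iff, given `1 − C₁M` invertible, `1 − C₂M′` is. [folklore] -/
theorem isUnit_det_one_sub_add_mul_iff {C₁ M : Matrix ι ι R} (C₂ : Matrix ι ι R)
    (h₁ : IsUnit (1 - C₁ * M).det) :
    IsUnit (1 - (C₁ + C₂) * M).det ↔ IsUnit (1 - C₂ * (M * (1 - C₁ * M)⁻¹)).det := by
  rw [det_one_sub_add_mul C₂ h₁, IsUnit.mul_iff]
  exact ⟨fun h => h.2, fun h => ⟨h₁, h⟩⟩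

/-- **The renormalised regulator composes**: `M′(1 − C₂M′)⁻¹ = M(1 − (C₁+C₂)M)⁻¹` for
`M′ = M(1 − C₁M)⁻¹` — integrating `C₁` then `C₂` ends with the same regulator as integrating `C₁ + C₂`.
[folklore] -/
theorem renorm_renorm {C₁ M : Matrix ι ι R} (C₂ : Matrix ι ι R) (h₁ : IsUnit (1 - C₁ * M).det) :
    M * (1 - C₁ * M)⁻¹ * (1 - C₂ * (M * (1 - C₁ * M)⁻¹))⁻¹ = M * (1 - (C₁ + C₂) * M)⁻¹ := by
  rw [Matrix.mul_assoc, ← Matrix.mul_inv_rev, one_sub_mul_renorm_mul_one_sub_mul C₂ h₁]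

/-- **The regulator flow** along a sequence of covariances `C₀, C₁, …`:
`M₀ = M`, `Mⱼ₊₁ = Mⱼ(1 − CⱼMⱼ)⁻¹`. [folklore] -/
noncomputable def regFlow (C : ℕ → Matrix ι ι R) (M : Matrix ι ι R) : ℕ → Matrix ι ι R
  | 0 => M
  | j + 1 => regFlow C M j * (1 - C j * regFlow C M j)⁻¹

/-- `M₀ = M`. [folklore] -/
@[simp] theorem regFlow_zero (C : ℕ → Matrix ι ι R) (M : Matrix ι ι R) : regFlow C M 0 = M := rfl

/-- `Mⱼ₊₁ = Mⱼ(1 − CⱼMⱼ)⁻¹`. [folklore] -/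
theorem regFlow_succ (C : ℕ → Matrix ι ι R) (M : Matrix ι ι R) (j : ℕ) :
    regFlow C M (j + 1) = regFlow C M j * (1 - C j * regFlow C M j)⁻¹ := rfl

/-- **Closed form of the regulator flow and the distributed determinant**: if every step is invertible,
`Mₙ = M(1 − (Σ_{j<n}Cⱼ)M)⁻¹`, `Π_{j<n} det(1 − CⱼMⱼ) = det(1 − (Σ_{j<n}Cⱼ)M)`, and the latter is a unit.
[folklore] -/
theorem regFlow_eq_and_prod_det (C : ℕ → Matrix ι ι R) (M : Matrix ι ι R) (n : ℕ)
    (h : ∀ j < n, IsUnit (1 - C j * regFlow C M j).det) :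
    regFlow C M n = M * (1 - (∑ j ∈ Finset.range n, C j) * M)⁻¹ ∧
      ∏ j ∈ Finset.range n, (1 - C j * regFlow C M j).det = (1 - (∑ j ∈ Finset.range n, C j) * M).det ∧
      IsUnit (1 - (∑ j ∈ Finset.range n, C j) * M).det := by
  induction n with
  | zero => simp
  | succ n ih =>
    obtain ⟨hflow, hprod, hunit⟩ := ih fun j hj => h j (Nat.lt_succ_of_lt hj)
    have hn := h n (Nat.lt_succ_self n)
    rw [hflow] at hn
    refine ⟨?_, ?_, ?_⟩
    · rw [regFlow_succ, hflow, renorm_renorm (C n) hunit, Finset.sum_range_succ]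
    · rw [Finset.prod_range_succ, hprod, hflow, Finset.sum_range_succ, det_one_sub_add_mul (C n) hunit]
    · rw [Finset.sum_range_succ, isUnit_det_one_sub_add_mul_iff (C n) hunit]
      exact hn

/-- `Mₙ = M(1 − (Σ_{j<n}Cⱼ)M)⁻¹`. [folklore] -/
theorem regFlow_eq (C : ℕ → Matrix ι ι R) (M : Matrix ι ι R) (n : ℕ)
    (h : ∀ j < n, IsUnit (1 - C j * regFlow C M j).det) :
    regFlow C M n = M * (1 - (∑ j ∈ Finset.range n, C j) * M)⁻¹ :=
  (regFlow_eq_and_prod_det C M n h).1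

/-- **The total determinant is distributed over the scales**:
`Π_{j<n} det(1 − CⱼMⱼ) = det(1 − (Σ_{j<n}Cⱼ)M)`. [folklore] -/
theorem prod_det_regFlow (C : ℕ → Matrix ι ι R) (M : Matrix ι ι R) (n : ℕ)
    (h : ∀ j < n, IsUnit (1 - C j * regFlow C M j).det) :
    ∏ j ∈ Finset.range n, (1 - C j * regFlow C M j).det = (1 - (∑ j ∈ Finset.range n, C j) * M).det :=
  (regFlow_eq_and_prod_det C M n h).2.1

/-! ### Finite-range additivity -/

/-- If `M_X C M_Y = 0` then `(1 − CM_X)(1 − CM_Y) = 1 − C(M_X + M_Y)`. [folklore] -/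
theorem one_sub_mul_mul_one_sub_mul_of_mul_mul_eq_zero {C X Y : Matrix ι ι R} (hXY : X * C * Y = 0) :
    (1 - C * X) * (1 - C * Y) = 1 - C * (X + Y) := by
  have h : C * X * (C * Y) = 0 := by
    rw [Matrix.mul_assoc, ← Matrix.mul_assoc X, hXY, Matrix.mul_zero]
  rw [Matrix.sub_mul, Matrix.one_mul, Matrix.mul_sub, Matrix.mul_one, h, sub_zero, Matrix.mul_add]
  abel

/-- **Determinant multiplicativity over non-interacting regulators**: if `M_X C M_Y = 0` then
`det(1 − C(M_X + M_Y)) = det(1 − CM_X)·det(1 − CM_Y)`. [folklore] -/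
theorem det_one_sub_mul_add_of_mul_mul_eq_zero {C X Y : Matrix ι ι R} (hXY : X * C * Y = 0) :
    (1 - C * (X + Y)).det = (1 - C * X).det * (1 - C * Y).det := by
  rw [← one_sub_mul_mul_one_sub_mul_of_mul_mul_eq_zero hXY, Matrix.det_mul]

omit [DecidableEq ι] in
/-- For symmetric `C, M_X, M_Y`, `M_X C M_Y = 0` implies `M_Y C M_X = 0`. [folklore] -/
theorem mul_mul_eq_zero_symm {C X Y : Matrix ι ι R} (hC : Cᵀ = C) (hX : Xᵀ = X) (hY : Yᵀ = Y)
    (hXY : X * C * Y = 0) : Y * C * X = 0 := by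
  have h := congrArg Matrix.transpose hXY
  rwa [Matrix.transpose_mul, Matrix.transpose_mul, hC, hX, hY, Matrix.transpose_zero,
    ← Matrix.mul_assoc] at h

/-- **Additivity of the renormalised regulator over non-interacting components**: if
`M_X C M_Y = 0 = M_Y C M_X` and both `1 − CM_X`, `1 − CM_Y` are invertible, then
`(M_X + M_Y)(1 − C(M_X+M_Y))⁻¹ = M_X(1 − CM_X)⁻¹ + M_Y(1 − CM_Y)⁻¹`. [folklore] -/
theorem renorm_add_of_mul_mul_eq_zero {C X Y : Matrix ι ι R} (hXY : X * C * Y = 0) (hYX : Y * C * X = 0)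
    (hX : IsUnit (1 - C * X).det) (hY : IsUnit (1 - C * Y).det) :
    (X + Y) * (1 - C * (X + Y))⁻¹ = X * (1 - C * X)⁻¹ + Y * (1 - C * Y)⁻¹ := by
  rw [← one_sub_mul_mul_one_sub_mul_of_mul_mul_eq_zero hXY, Matrix.mul_inv_rev, Matrix.add_mul,
    ← Matrix.mul_assoc, ← Matrix.mul_assoc]
  congr 1
  · -- `X(1 − CY)⁻¹ = X` because `X(1 − CY) = X`
    have h1 : X * (1 - C * Y) = X := by
      rw [Matrix.mul_sub, Matrix.mul_one, ← Matrix.mul_assoc, hXY, sub_zero]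
    have h1' : X * (1 - C * Y)⁻¹ = X := by
      conv_lhs => rw [← h1]
      rw [Matrix.mul_nonsing_inv_cancel_right _ _ hY]
    rw [h1']
  · -- `Y′(1 − CX) = Y′` for `Y′ = Y(1 − CY)⁻¹ = (1 − YC)⁻¹Y`, because `YCX = 0`
    have h2 : Y * (1 - C * Y)⁻¹ * (1 - C * X) = Y * (1 - C * Y)⁻¹ := by
      rw [mul_inv_one_sub_mul hY, Matrix.mul_assoc, Matrix.mul_sub, Matrix.mul_one,
        ← Matrix.mul_assoc Y, hYX, sub_zero]
    conv_lhs => rw [← h2, Matrix.mul_nonsing_inv_cancel_right _ _ hX]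

/-- **Finset version of the determinant multiplicativity**: for pairwise non-interacting regulators
(`M_a C M_b = 0` for `a ≠ b`), `det(1 − C Σ_{a∈s} M_a) = Π_{a∈s} det(1 − C M_a)`. [folklore] -/
theorem det_one_sub_mul_sum_of_pairwise {κ : Type*} (s : Finset κ) {C : Matrix ι ι R}
    {M : κ → Matrix ι ι R} (hM : ∀ a ∈ s, ∀ b ∈ s, a ≠ b → M a * C * M b = 0) :
    (1 - C * ∑ a ∈ s, M a).det = ∏ a ∈ s, (1 - C * M a).det := by
  classical
  induction s using Finset.induction_on with
  | empty => simp
  | insert b s hb ih =>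
    have hM' : ∀ a ∈ s, ∀ a' ∈ s, a ≠ a' → M a * C * M a' = 0 := fun a ha a' ha' hne =>
      hM a (Finset.mem_insert_of_mem ha) a' (Finset.mem_insert_of_mem ha') hne
    have hcross : M b * C * (∑ a ∈ s, M a) = 0 := by
      rw [Matrix.mul_sum]
      refine Finset.sum_eq_zero fun a ha => ?_
      exact hM b (Finset.mem_insert_self b s) a (Finset.mem_insert_of_mem ha)
        (fun h => hb (h ▸ ha))
    rw [Finset.sum_insert hb, Finset.prod_insert hb, det_one_sub_mul_add_of_mul_mul_eq_zero hcross,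
      ih hM']

/-- **Finset version of the additivity of the renormalised regulator**: for pairwise non-interacting
regulators with every `1 − CM_a` invertible,
`(Σ_a M_a)(1 − CΣ_aM_a)⁻¹ = Σ_a M_a(1 − CM_a)⁻¹`, and `1 − CΣ_aM_a` is invertible. [folklore] -/
theorem renorm_sum_of_pairwise {κ : Type*} (s : Finset κ) {C : Matrix ι ι R} {M : κ → Matrix ι ι R}
    (hM : ∀ a ∈ s, ∀ b ∈ s, a ≠ b → M a * C * M b = 0) (hU : ∀ a ∈ s, IsUnit (1 - C * M a).det) :
    (∑ a ∈ s, M a) * (1 - C * ∑ a ∈ s, M a)⁻¹ = ∑ a ∈ s, M a * (1 - C * M a)⁻¹ ∧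
      IsUnit (1 - C * ∑ a ∈ s, M a).det := by
  classical
  induction s using Finset.induction_on with
  | empty => simp
  | insert b s hb ih =>
    have hM' : ∀ a ∈ s, ∀ a' ∈ s, a ≠ a' → M a * C * M a' = 0 := fun a ha a' ha' hne =>
      hM a (Finset.mem_insert_of_mem ha) a' (Finset.mem_insert_of_mem ha') hne
    obtain ⟨hsum, hunit⟩ := ih hM' fun a ha => hU a (Finset.mem_insert_of_mem ha)
    have hbU := hU b (Finset.mem_insert_self b s)
    have hcross : M b * C * (∑ a ∈ s, M a) = 0 := by
      rw [Matrix.mul_sum]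
      refine Finset.sum_eq_zero fun a ha => ?_
      exact hM b (Finset.mem_insert_self b s) a (Finset.mem_insert_of_mem ha) (fun h => hb (h ▸ ha))
    have hcross' : (∑ a ∈ s, M a) * C * M b = 0 := by
      rw [Matrix.sum_mul, Matrix.sum_mul]
      refine Finset.sum_eq_zero fun a ha => ?_
      exact hM a (Finset.mem_insert_of_mem ha) b (Finset.mem_insert_self b s) (fun h => hb (h ▸ ha))
    refine ⟨?_, ?_⟩
    · rw [Finset.sum_insert hb, Finset.sum_insert hb,
        renorm_add_of_mul_mul_eq_zero hcross hcross' hbU hunit, hsum]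
    · rw [Finset.sum_insert hb, det_one_sub_mul_add_of_mul_mul_eq_zero hcross]
      exact hbU.mul hunit


/-! ### Support calculus: when do two regulators not interact through `C`? -/

omit [DecidableEq ι] in
/-- Sandwiched regulators whose masks see a zero block of `C` do not interact:
`X = PXP`, `Y = QYQ`, `PCQ = 0 ⟹ XCY = 0`. [folklore] -/
theorem mul_mul_eq_zero_of_sandwich {C X Y P Q : Matrix ι ι R} (hX : X = P * X * P) (hY : Y = Q * Y * Q)
    (hC : P * C * Q = 0) : X * C * Y = 0 := by
  rw [hX, hY]
  calc P * X * P * C * (Q * Y * Q) = P * X * (P * C * Q) * Y * Q := by simp only [Matrix.mul_assoc]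
    _ = 0 := by rw [hC, Matrix.mul_zero, Matrix.zero_mul, Matrix.zero_mul]

/-- A block of `C` between two diagonal masks vanishes as soon as `C x y = 0` whenever both masks are
non-zero (e.g. indicator masks of two sets of sites farther apart than the range of `C`). [folklore] -/
theorem diagonal_mul_mul_diagonal_eq_zero {C : Matrix ι ι R} {d₁ d₂ : ι → R}
    (h : ∀ x y, d₁ x ≠ 0 → d₂ y ≠ 0 → C x y = 0) : Matrix.diagonal d₁ * C * Matrix.diagonal d₂ = 0 := by
  ext x y
  rw [Matrix.mul_apply, Matrix.zero_apply]
  refine Finset.sum_eq_zero fun z _ => ?_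
  rw [Matrix.diagonal_mul, Matrix.diagonal_apply]
  split_ifs with hzy
  · subst hzy
    by_cases h1 : d₁ x = 0
    · rw [h1, zero_mul, zero_mul]
    by_cases h2 : d₂ z = 0
    · rw [h2, mul_zero]
    rw [h x z h1 h2, mul_zero, zero_mul]
  · rw [mul_zero]

/-- An indicator-type diagonal mask (`d x ∈ {0, 1}`) is idempotent. [folklore] -/
theorem diagonal_mul_diagonal_self_of_sq {d : ι → R} (hd : ∀ x, d x * d x = d x) :
    Matrix.diagonal d * Matrix.diagonal d = Matrix.diagonal d := by
  rw [Matrix.diagonal_mul_diagonal]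
  congr 1
  funext x
  exact hd x

/-- **The regulator flow never leaves the support of the initial regulator**: if `M = PMP` for an
idempotent `P` and every step is invertible, then `Mⱼ = PMⱼP` for all `j ≤ n`. [folklore] -/
theorem regFlow_eq_sandwich (C : ℕ → Matrix ι ι R) {M P : Matrix ι ι R} (n : ℕ) (hP : P * P = P)
    (hM : M = P * M * P) (h : ∀ j < n, IsUnit (1 - C j * regFlow C M j).det) :
    ∀ j ≤ n, regFlow C M j = P * regFlow C M j * P := by
  intro j
  induction j with
  | zero => intro _; simpa using hM
  | succ j ih =>
    intro hj
    have hjn : j < n := Nat.lt_of_succ_le hj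
    rw [regFlow_succ]
    exact renorm_eq_sandwich (h j hjn) hP (ih hjn.le)

end Literature.Analysis.Matrix
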